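import Summits.Ventures.PercRepro.Night2LineRank

/-!
# night-2: THE HITTING LINE FAMILY WITH THE RANK UPGRADE (gen 39)

In the hitting line family of Night2LineHit the off-line sets `O` and `O ∖ {y}` (`y ∈ O`) are hitting (every hole set has
`≥ 2` points) and have `rk (O ∖ Y_O) ≤ 1`, so their targets have `vCap = 1` (Night2LineRank's `line_rank_term`) instead of
`≥ 11/18`.  Weighting the family accordingly gives
`lineHitUpIncome q d k := lineHitIncome q d k + (7/18) · (lineRankIncome q d k + k · lineRankIncome q d (k − 1))` (`k ≥ 4`),
and **`basis_pair_fair_of_line_hit_up`**: `1 ≤ lineHitUpIncome q d k` ⇒ fair.  The cell `(6, 5)`: `1.06 / 1.16 / 1.34`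
(`basis_pair_fair_of_six_five`).  Paper: proofs/NIGHT-2-g39.md §4.
-/

namespace PercRepro.Shadow

open PercRepro.ThmH PercRepro.PerFlat

variable {α : Type*} [DecidableEq α] {M : Matroid α} [M.Finite] {G : Finset α}

/-- The upgraded line-hitting income:
`Σ_{j=4}^{d} C(d, j) · (hitInner q k j + (7/18) · (3 / lineFaceBound (j + q) (k + 5 − q) + k · 3 / lineFaceBound (j + q) (k − 1 + 5 − q)))`
(`= lineHitIncome q d k + (7/18) · (lineRankIncome q d k + k · lineRankIncome q d (k − 1))`). -/
noncomputable def lineHitUpIncome (q d k : ℕ) : ℚ :=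
  ∑ j ∈ Finset.range (d + 1), if 4 ≤ j then ((d.choose j : ℕ) : ℚ) * (hitInner q k j + 7 / 18 *
    (3 / ((lineFaceBound (j + q) (k + 5 - q) : ℕ) : ℚ) +
      (k : ℚ) * (3 / ((lineFaceBound (j + q) (k - 1 + 5 - q) : ℕ) : ℚ)))) else 0

/-- **The abstract weighted inner count**: weights `c ≥ 11/18` on the hitting subsets, `c = 1` on `O` and the `O ∖ {y}`
(`|O| ≥ 4`): `Σ c Y · 3 / lineFaceBound (j + q) (|Y| + 5 − q) ≥ hitInner q |O| j + (7/18) · (f |O| + |O| · f (|O| − 1))`. -/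
theorem hitInner_up_le_sum_filter {β : Type*} (O : Finset α) (A : Finset β) (C : β → Finset α)
    (hC : ∀ w ∈ A, (C w ∩ O).card + 2 ≤ O.card) (hA : A.card ≤ 3) (hk4 : 4 ≤ O.card) (q j : ℕ)
    (c : Finset α → ℚ)
    (hc : ∀ Y ∈ O.powerset.filter (fun YO => 3 ≤ YO.card ∧ ∀ w ∈ A, ¬ YO ⊆ C w), 11 / 18 ≤ c Y)
    (hcO : c O = 1) (hcy : ∀ y ∈ O, c (O.erase y) = 1) :
    hitInner q O.card j + 7 / 18 * (3 / ((lineFaceBound (j + q) (O.card + 5 - q) : ℕ) : ℚ) +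
      (O.card : ℚ) * (3 / ((lineFaceBound (j + q) (O.card - 1 + 5 - q) : ℕ) : ℚ))) ≤
    ∑ YO ∈ O.powerset.filter (fun YO => 3 ≤ YO.card ∧ ∀ w ∈ A, ¬ YO ⊆ C w),
      c YO * (3 / ((lineFaceBound (j + q) (YO.card + 5 - q) : ℕ) : ℚ)) := by
  set Os : Finset (Finset α) := O.powerset.filter (fun YO => 3 ≤ YO.card ∧ ∀ w ∈ A, ¬ YO ⊆ C w) with hOs
  -- the two special members
  have hOmem : O ∈ Os := by
    rw [hOs, Finset.mem_filter, Finset.mem_powerset]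
    refine ⟨Finset.Subset.refl _, by omega, ?_⟩
    intro w hw hsub
    have h1 := hC w hw
    have h2 : O ⊆ C w ∩ O := Finset.subset_inter hsub (Finset.Subset.refl _)
    have := Finset.card_le_card h2
    omega
  have hOy : ∀ y ∈ O, O.erase y ∈ Os := by
    intro y hy
    rw [hOs, Finset.mem_filter, Finset.mem_powerset]
    refine ⟨Finset.erase_subset _ _, ?_, ?_⟩
    · rw [Finset.card_erase_of_mem hy]
      omega
    · intro w hw hsub
      have h1 := hC w hw
      have h2 : O.erase y ⊆ C w ∩ O := Finset.subset_inter hsub (Finset.erase_subset _ _)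
      have := Finset.card_le_card h2
      rw [Finset.card_erase_of_mem hy] at this
      omega
  set 𝒴 : Finset (Finset α) := insert O (O.image (fun u => O.erase u)) with h𝒴def
  have hOnot : O ∉ O.image (fun u => O.erase u) := by
    intro h
    rw [Finset.mem_image] at h
    obtain ⟨u, hu, heu⟩ := h
    have := Finset.card_erase_of_mem hu
    rw [heu] at this
    omega
  have hinj : Set.InjOn (fun u => O.erase u) (O : Set α) := by
    intro u₁ hu₁ u₂ hu₂ heq
    rw [Finset.mem_coe] at hu₁ hu₂
    simp only at heq
    by_contra hne
    have : u₁ ∈ O.erase u₂ := Finset.mem_erase.2 ⟨hne, hu₁⟩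
    rw [← heq] at this
    exact (Finset.mem_erase.1 this).1 rfl
  have h𝒴sub : 𝒴 ⊆ Os := by
    intro Y hY
    rw [h𝒴def, Finset.mem_insert, Finset.mem_image] at hY
    rcases hY with rfl | ⟨u, hu, rfl⟩
    · exact hOmem
    · exact hOy u hu
  -- split the weights: `c = 11/18 + (c − 11/18)`
  have hsplit : ∑ YO ∈ Os, c YO * (3 / ((lineFaceBound (j + q) (YO.card + 5 - q) : ℕ) : ℚ)) =
      ∑ YO ∈ Os, 11 / 18 * 3 / ((lineFaceBound (j + q) (YO.card + 5 - q) : ℕ) : ℚ) +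
      ∑ YO ∈ Os, (c YO - 11 / 18) * (3 / ((lineFaceBound (j + q) (YO.card + 5 - q) : ℕ) : ℚ)) := by
    rw [← Finset.sum_add_distrib]
    apply Finset.sum_congr rfl
    intro YO _
    ring
  rw [hsplit]
  have h1 := hitInner_le_sum_filter O A C hC hA q j
  have h2 : ∑ YO ∈ 𝒴, (c YO - 11 / 18) * (3 / ((lineFaceBound (j + q) (YO.card + 5 - q) : ℕ) : ℚ)) ≤
      ∑ YO ∈ Os, (c YO - 11 / 18) * (3 / ((lineFaceBound (j + q) (YO.card + 5 - q) : ℕ) : ℚ)) := by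
    apply Finset.sum_le_sum_of_subset_of_nonneg h𝒴sub
    intro Y hY _
    have := hc Y hY
    have h0 : (0 : ℚ) ≤ 3 / ((lineFaceBound (j + q) (Y.card + 5 - q) : ℕ) : ℚ) := by positivity
    nlinarith
  have h3 : ∑ YO ∈ 𝒴, (c YO - 11 / 18) * (3 / ((lineFaceBound (j + q) (YO.card + 5 - q) : ℕ) : ℚ)) =
      7 / 18 * (3 / ((lineFaceBound (j + q) (O.card + 5 - q) : ℕ) : ℚ) +
        (O.card : ℚ) * (3 / ((lineFaceBound (j + q) (O.card - 1 + 5 - q) : ℕ) : ℚ))) := by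
    rw [h𝒴def, Finset.sum_insert hOnot, Finset.sum_image hinj, hcO]
    have hconst : ∑ u ∈ O, (c (O.erase u) - 11 / 18) *
        (3 / ((lineFaceBound (j + q) ((O.erase u).card + 5 - q) : ℕ) : ℚ)) =
        (O.card : ℚ) * (7 / 18 * (3 / ((lineFaceBound (j + q) (O.card - 1 + 5 - q) : ℕ) : ℚ))) := by
      rw [Finset.sum_congr rfl (fun u hu => by rw [Finset.card_erase_of_mem hu, hcy u hu])]
      rw [Finset.sum_const, nsmul_eq_mul]
      ring
    rw [hconst]
    ring
  linarith

/-- **The weighted per-target bound**: `1` when `rk (O ∖ Y_O) ≤ 1`, `11/18` otherwise (`|Y_D| ≥ 4`, `|Y_O| ≥ 3`, hitting). -/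
theorem line_hit_up_term (hG : G ∈ flatsQ M (5 + 1)) (hd : (gr M \ G).card = 2)
    (hk : kColoops M G = 1) (hs : ∀ e ∈ gr M, ∀ f ∈ gr M, e ≠ f → rkN M {e, f} = 2)
    (hl : ∀ e ∈ gr M, M.Indep {e}) (hnf : fatClosures M 5 G 2 = ∅) {B : Finset α}
    (hB : B ∈ thinMembers M 5 G) (hnP : ¬ bigP M G B) {z : α} (hz : z ∈ G \ clF M B)
    (hl0 : loss M 5 G B z ≠ 0) {x y : α}
    {YD YO : Finset α} (hYD : YD ⊆ (G \ insert z B) ∩ clF M {x, y}) (h4 : 4 ≤ YD.card)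
    (hYO : YO ⊆ (G \ insert z B) \ clF M {x, y}) (h3 : 3 ≤ YO.card)
    (hhit : ∀ w ∈ (insert z B \ coloops M G).filter (fun w => faceOk M G (insert z B) w ∧
      clF M {x, y} ⊆ clF M ((insert z B).erase w)), ¬ YO ⊆ clF M ((insert z B).erase w)) :
    (if rkN M (((G \ insert z B) \ clF M {x, y}) \ YO) ≤ 1 then (1 : ℚ) else 11 / 18) *
      (3 / ((lineFaceBound (YD.card + ((insert z B \ coloops M G) ∩ clF M {x, y}).card)
        (YO.card + 5 - ((insert z B \ coloops M G) ∩ clF M {x, y}).card) : ℕ) : ℚ)) ≤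
      vCap M G (insert z B ∪ (YD ∪ YO)) / faceSum M G (insert z B ∪ (YD ∪ YO)) := by
  have hind : M.Indep ((insert z B \ coloops M G : Finset α) : Set α) :=
    (indep_insert_of_basis_pair hG hd hk hB hnP hz).subset (by exact_mod_cast (Finset.sdiff_subset))
  have hq2 := card_inter_clF_pair_le_two_of_indep hind (a := x) (b := y)
  split_ifs with hrk
  · rw [one_mul]
    exact line_rank_term hG hd hk hs hl hnf hB hnP hz hl0 hYD h4 hYO (by omega) hrk
  · have h := line_hit_term hG hd hk hs hl hnf hB hnP hz hl0 hYD h4 hYO h3 hhit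
    calc 11 / 18 * (3 / ((lineFaceBound (YD.card + ((insert z B \ coloops M G) ∩ clF M {x, y}).card)
          (YO.card + 5 - ((insert z B \ coloops M G) ∩ clF M {x, y}).card) : ℕ) : ℚ))
        = 11 / 18 * 3 / ((lineFaceBound (YD.card + ((insert z B \ coloops M G) ∩ clF M {x, y}).card)
          (YO.card + 5 - ((insert z B \ coloops M G) ∩ clF M {x, y}).card) : ℕ) : ℚ) := by ring
      _ ≤ _ := h

/-- **The upgraded hitting line family**: its income is at least `lineHitUpIncome q d k` (`k = |W ∖ cl {x, y}| ≥ 4`). -/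
theorem line_hit_up_targets_subset_and_income (hG : G ∈ flatsQ M (5 + 1)) (hd : (gr M \ G).card = 2)
    (hk : kColoops M G = 1) (hs : ∀ e ∈ gr M, ∀ f ∈ gr M, e ≠ f → rkN M {e, f} = 2)
    (hl : ∀ e ∈ gr M, M.Indep {e}) (hnf : fatClosures M 5 G 2 = ∅) {B : Finset α}
    (hB : B ∈ thinMembers M 5 G) (hnP : ¬ bigP M G B) {z : α} (hz : z ∈ G \ clF M B)
    (hl0 : loss M 5 G B z ≠ 0) {x y : α} (hx : x ∈ G \ coloops M G) (hy : y ∈ G \ coloops M G) (hxy : x ≠ y)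
    (hk4 : 4 ≤ ((G \ insert z B) \ clF M {x, y}).card) :
    (((((G \ insert z B) ∩ clF M {x, y}).powerset.filter (fun YD => 4 ≤ YD.card)) ×ˢ
      (((G \ insert z B) \ clF M {x, y}).powerset.filter (fun YO => 3 ≤ YO.card ∧
        ∀ w ∈ (insert z B \ coloops M G).filter (fun w => faceOk M G (insert z B) w ∧
          clF M {x, y} ⊆ clF M ((insert z B).erase w)), ¬ YO ⊆ clF M ((insert z B).erase w)))).image
        (fun p => insert z B ∪ (p.1 ∪ p.2))) ⊆ tgtSets M 5 G B z ∧
      lineHitUpIncome ((insert z B \ coloops M G) ∩ clF M {x, y}).card ((G \ insert z B) ∩ clF M {x, y}).card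
        ((G \ insert z B) \ clF M {x, y}).card ≤
      ∑ T ∈ ((((G \ insert z B) ∩ clF M {x, y}).powerset.filter (fun YD => 4 ≤ YD.card)) ×ˢ
        (((G \ insert z B) \ clF M {x, y}).powerset.filter (fun YO => 3 ≤ YO.card ∧
          ∀ w ∈ (insert z B \ coloops M G).filter (fun w => faceOk M G (insert z B) w ∧
            clF M {x, y} ⊆ clF M ((insert z B).erase w)), ¬ YO ⊆ clF M ((insert z B).erase w)))).image
          (fun p => insert z B ∪ (p.1 ∪ p.2)), vCap M G T / faceSum M G T := by
  have hQG : insert z B ⊆ G :=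
    Finset.insert_subset (Finset.mem_sdiff.1 hz).1 (subset_G_of_mem_thinMembers hB)
  have hA3 := card_filter_line_faces_le_three hG hd hk hs hB hnP hz hx hy hxy
  set D : Finset α := (G \ insert z B) ∩ clF M {x, y} with hDdef
  set O : Finset α := (G \ insert z B) \ clF M {x, y} with hOdef
  set Aℓ : Finset α := (insert z B \ coloops M G).filter (fun w => faceOk M G (insert z B) w ∧
    clF M {x, y} ⊆ clF M ((insert z B).erase w)) with hAdef
  set Ds : Finset (Finset α) := D.powerset.filter (fun YD => 4 ≤ YD.card) with hDs
  set Os : Finset (Finset α) := O.powerset.filter (fun YO => 3 ≤ YO.card ∧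
    ∀ w ∈ Aℓ, ¬ YO ⊆ clF M ((insert z B).erase w)) with hOs
  set 𝒯 : Finset (Finset α) := (Ds ×ˢ Os).image (fun p => insert z B ∪ (p.1 ∪ p.2)) with h𝒯
  set c : Finset α → ℚ := fun YO => if rkN M (O \ YO) ≤ 1 then (1 : ℚ) else 11 / 18 with hcdef
  have hmemD : ∀ YD ∈ Ds, YD ⊆ D ∧ 4 ≤ YD.card := fun YD hYD => by
    have := Finset.mem_filter.1 hYD
    exact ⟨Finset.mem_powerset.1 this.1, this.2⟩
  have hmemO : ∀ YO ∈ Os, YO ⊆ O ∧ 3 ≤ YO.card ∧ ∀ w ∈ Aℓ, ¬ YO ⊆ clF M ((insert z B).erase w) :=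
    fun YO hYO => by
      have := Finset.mem_filter.1 hYO
      exact ⟨Finset.mem_powerset.1 this.1, this.2.1, this.2.2⟩
  have hDW : D ⊆ G \ insert z B := Finset.inter_subset_left
  have hOW : O ⊆ G \ insert z B := Finset.sdiff_subset
  -- the targets (as in Night2LineHit)
  have h𝒯sub : 𝒯 ⊆ tgtSets M 5 G B z := by
    intro T hT
    rw [h𝒯, Finset.mem_image] at hT
    obtain ⟨p, hp, rfl⟩ := hT
    rw [Finset.mem_product] at hp
    obtain ⟨hYD, hYDc⟩ := hmemD p.1 hp.1
    obtain ⟨hYO, hYOc, -⟩ := hmemO p.2 hp.2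
    rw [tgtSets_eq_image hG (mem_thinMembers.1 hB).1 hz, Finset.mem_image]
    refine ⟨p.1 ∪ p.2, Finset.mem_filter.2 ⟨Finset.mem_powerset.2
      (Finset.union_subset (hYD.trans hDW) (hYO.trans hOW)), ?_⟩, rfl⟩
    exact Finset.Nonempty.mono Finset.subset_union_left (Finset.card_pos.1 (by omega))
  have hinj : Set.InjOn (fun p : Finset α × Finset α => insert z B ∪ (p.1 ∪ p.2))
      ((Ds ×ˢ Os : Finset _) : Set _) := by
    intro p₁ hp₁ p₂ hp₂ heq
    rw [Finset.mem_coe, Finset.mem_product] at hp₁ hp₂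
    have keyD : ∀ p ∈ Ds ×ˢ Os, (insert z B ∪ (p.1 ∪ p.2)) ∩ D = p.1 := by
      intro p hp
      rw [Finset.mem_product] at hp
      ext e
      rw [Finset.mem_inter, Finset.mem_union, Finset.mem_union]
      constructor
      · rintro ⟨he | he | he, heD⟩
        · exact absurd he (Finset.mem_sdiff.1 (hDW heD)).2
        · exact he
        · exact absurd (Finset.mem_inter.1 heD).2 (Finset.mem_sdiff.1 ((hmemO p.2 hp.2).1 he)).2
      · intro he
        exact ⟨Or.inr (Or.inl he), (hmemD p.1 hp.1).1 he⟩
    have keyO : ∀ p ∈ Ds ×ˢ Os, (insert z B ∪ (p.1 ∪ p.2)) ∩ O = p.2 := by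
      intro p hp
      rw [Finset.mem_product] at hp
      ext e
      rw [Finset.mem_inter, Finset.mem_union, Finset.mem_union]
      constructor
      · rintro ⟨he | he | he, heO⟩
        · exact absurd he (Finset.mem_sdiff.1 (hOW heO)).2
        · exact absurd (Finset.mem_inter.1 ((hmemD p.1 hp.1).1 he)).2 (Finset.mem_sdiff.1 heO).2
        · exact he
      · intro he
        exact ⟨Or.inr (Or.inr he), (hmemO p.2 hp.2).1 he⟩
    have hD₁ := keyD p₁ (Finset.mem_product.2 hp₁)
    have hD₂ := keyD p₂ (Finset.mem_product.2 hp₂)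
    have hO₁ := keyO p₁ (Finset.mem_product.2 hp₁)
    have hO₂ := keyO p₂ (Finset.mem_product.2 hp₂)
    simp only at heq
    apply Prod.ext
    · rw [← hD₁, ← hD₂, heq]
    · rw [← hO₁, ← hO₂, heq]
  -- the weighted per-target bound
  have hterm : ∀ p ∈ Ds ×ˢ Os, c p.2 * (3 / ((lineFaceBound (p.1.card +
      ((insert z B \ coloops M G) ∩ clF M {x, y}).card)
      (p.2.card + 5 - ((insert z B \ coloops M G) ∩ clF M {x, y}).card) : ℕ) : ℚ)) ≤
      vCap M G (insert z B ∪ (p.1 ∪ p.2)) / faceSum M G (insert z B ∪ (p.1 ∪ p.2)) := by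
    intro p hp
    rw [Finset.mem_product] at hp
    obtain ⟨hYD, hYDc⟩ := hmemD p.1 hp.1
    obtain ⟨hYO, hYOc, hYOhit⟩ := hmemO p.2 hp.2
    exact line_hit_up_term hG hd hk hs hl hnf hB hnP hz hl0 hYD hYDc hYO hYOc hYOhit
  have hsum𝒯 : ∑ p ∈ Ds ×ˢ Os, c p.2 * (3 / ((lineFaceBound (p.1.card +
      ((insert z B \ coloops M G) ∩ clF M {x, y}).card)
      (p.2.card + 5 - ((insert z B \ coloops M G) ∩ clF M {x, y}).card) : ℕ) : ℚ)) ≤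
      ∑ T ∈ 𝒯, vCap M G T / faceSum M G T := by
    rw [h𝒯, Finset.sum_image hinj]
    exact Finset.sum_le_sum hterm
  rw [Finset.sum_product] at hsum𝒯
  refine ⟨h𝒯sub, le_trans ?_ hsum𝒯⟩
  -- the holes of the faces containing the line lie in `O`
  have hC : ∀ w ∈ Aℓ, (clF M ((insert z B).erase w) ∩ O).card + 2 ≤ O.card := by
    intro w hw
    rw [hAdef, Finset.mem_filter] at hw
    have hholes := two_le_card_holes hG hnf hQG hw.2.1
    have hsub : (G \ insert z B) \ clF M ((insert z B).erase w) ⊆ O \ clF M ((insert z B).erase w) := by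
      intro e he
      rw [Finset.mem_sdiff] at he ⊢
      exact ⟨Finset.mem_sdiff.2 ⟨he.1, fun hel => he.2 (hw.2.2 hel)⟩, he.2⟩
    have h1 := Finset.card_le_card hsub
    have h2 := Finset.card_sdiff_add_card_inter O (clF M ((insert z B).erase w))
    rw [Finset.inter_comm]
    omega
  -- the weights on `O` and the `O ∖ {u}`
  have hcO : c O = 1 := by
    rw [hcdef]
    simp only
    rw [if_pos]
    rw [Finset.sdiff_self]
    have := rkN_le_card (M := M) (∅ : Finset α)
    rw [Finset.card_empty] at this
    omega
  have hcy : ∀ u ∈ O, c (O.erase u) = 1 := by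
    intro u hu
    rw [hcdef]
    simp only
    rw [if_pos]
    have hsd : O \ O.erase u = {u} := by
      ext e
      simp only [Finset.mem_sdiff, Finset.mem_erase, Finset.mem_singleton, not_and]
      constructor
      · rintro ⟨heO, h⟩
        by_contra heu
        exact h heu heO
      · rintro rfl
        exact ⟨hu, fun h _ => h rfl⟩
    rw [hsd]
    exact le_trans (rkN_le_card _) (by simp)
  have hc : ∀ Y ∈ Os, 11 / 18 ≤ c Y := by
    intro Y _
    rw [hcdef]
    simp only
    split_ifs <;> norm_num
  have hinner : ∀ YD ∈ Ds,
      hitInner ((insert z B \ coloops M G) ∩ clF M {x, y}).card O.card YD.card + 7 / 18 *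
        (3 / ((lineFaceBound (YD.card + ((insert z B \ coloops M G) ∩ clF M {x, y}).card)
          (O.card + 5 - ((insert z B \ coloops M G) ∩ clF M {x, y}).card) : ℕ) : ℚ) +
        (O.card : ℚ) * (3 / ((lineFaceBound (YD.card + ((insert z B \ coloops M G) ∩ clF M {x, y}).card)
          (O.card - 1 + 5 - ((insert z B \ coloops M G) ∩ clF M {x, y}).card) : ℕ) : ℚ))) ≤
      ∑ YO ∈ Os, c YO * (3 / ((lineFaceBound (YD.card + ((insert z B \ coloops M G) ∩ clF M {x, y}).card)
        (YO.card + 5 - ((insert z B \ coloops M G) ∩ clF M {x, y}).card) : ℕ) : ℚ)) := fun YD _ =>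
    hitInner_up_le_sum_filter O Aℓ (fun w => clF M ((insert z B).erase w)) hC hA3 hk4 _ YD.card c hc hcO hcy
  refine le_trans ?_ (Finset.sum_le_sum hinner)
  -- the outer sum: regroup by `|Y_D|`
  unfold lineHitUpIncome
  rw [hDs, Finset.sum_filter]
  rw [Finset.sum_powerset_apply_card (fun j => if 4 ≤ j then
    hitInner ((insert z B \ coloops M G) ∩ clF M {x, y}).card O.card j + 7 / 18 *
      (3 / ((lineFaceBound (j + ((insert z B \ coloops M G) ∩ clF M {x, y}).card)
        (O.card + 5 - ((insert z B \ coloops M G) ∩ clF M {x, y}).card) : ℕ) : ℚ) +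
      (O.card : ℚ) * (3 / ((lineFaceBound (j + ((insert z B \ coloops M G) ∩ clF M {x, y}).card)
        (O.card - 1 + 5 - ((insert z B \ coloops M G) ∩ clF M {x, y}).card) : ℕ) : ℚ))) else 0)]
  apply le_of_eq
  apply Finset.sum_congr rfl
  intro j _
  rw [nsmul_eq_mul]
  split_ifs
  · rfl
  · rw [mul_zero]

/-- **THE UPGRADED HITTING LINE THEOREM**: `1 ≤ lineHitUpIncome q d k` (`k ≥ 4`) ⇒ fair. -/
theorem basis_pair_fair_of_line_hit_up (hG : G ∈ flatsQ M (5 + 1)) (hd : (gr M \ G).card = 2)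
    (hk : kColoops M G = 1) (hs : ∀ e ∈ gr M, ∀ f ∈ gr M, e ≠ f → rkN M {e, f} = 2)
    (hl : ∀ e ∈ gr M, M.Indep {e}) (hnf : fatClosures M 5 G 2 = ∅) {B : Finset α}
    (hB : B ∈ thinMembers M 5 G) (hnP : ¬ bigP M G B) {z : α} (hz : z ∈ G \ clF M B)
    (hl0 : loss M 5 G B z ≠ 0) {x y : α} (hx : x ∈ G \ coloops M G) (hy : y ∈ G \ coloops M G) (hxy : x ≠ y)
    (hk4 : 4 ≤ ((G \ insert z B) \ clF M {x, y}).card)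
    (hsum : 1 ≤ lineHitUpIncome ((insert z B \ coloops M G) ∩ clF M {x, y}).card
      ((G \ insert z B) ∩ clF M {x, y}).card ((G \ insert z B) \ clF M {x, y}).card) :
    loss M 5 G B z ≤ rhoL M 5 G B z * lossIncomeH M 5 G (bigP M G) (dshGT2 M 5 G) B z := by
  have hfat : (fatClosures M 5 G 2).card ≤ 1 := by
    rw [hnf, Finset.card_empty]
    exact zero_le_one
  obtain ⟨hsub, hinc⟩ := line_hit_up_targets_subset_and_income hG hd hk hs hl hnf hB hnP hz hl0 hx hy hxy hk4
  exact basis_pair_fair_of_vCap_face_sum_subfamily hG hd hk hs hl hfat hB hnP hz hl0 hsub (hsum.trans hinc)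

/-- `lineHitUpIncome q 6 5 ≥ 1` for `q ≤ 2` (`1.06 / 1.16 / 1.34`). -/
theorem one_le_lineHitUpIncome_six_five {q : ℕ} (hq : q ≤ 2) : 1 ≤ lineHitUpIncome q 6 5 := by
  interval_cases q <;>
    (unfold lineHitUpIncome hitInner
     simp only [Finset.sum_range_succ, Finset.sum_range_zero]
     norm_num [lineFaceBound, Nat.choose, max_def])

/-- **The cell `(6, 5)`**: six points of `W` on a line, five off it ⇒ fair (every `q`). -/
theorem basis_pair_fair_of_six_five (hG : G ∈ flatsQ M (5 + 1)) (hd : (gr M \ G).card = 2)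
    (hk : kColoops M G = 1) (hs : ∀ e ∈ gr M, ∀ f ∈ gr M, e ≠ f → rkN M {e, f} = 2)
    (hl : ∀ e ∈ gr M, M.Indep {e}) (hnf : fatClosures M 5 G 2 = ∅) {B : Finset α}
    (hB : B ∈ thinMembers M 5 G) (hnP : ¬ bigP M G B) {z : α} (hz : z ∈ G \ clF M B)
    (hl0 : loss M 5 G B z ≠ 0) {x y : α} (hx : x ∈ G \ coloops M G) (hy : y ∈ G \ coloops M G) (hxy : x ≠ y)
    (hd6 : ((G \ insert z B) ∩ clF M {x, y}).card = 6) (hk5 : ((G \ insert z B) \ clF M {x, y}).card = 5) :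
    loss M 5 G B z ≤ rhoL M 5 G B z * lossIncomeH M 5 G (bigP M G) (dshGT2 M 5 G) B z := by
  have hind : M.Indep ((insert z B \ coloops M G : Finset α) : Set α) :=
    (indep_insert_of_basis_pair hG hd hk hB hnP hz).subset (by exact_mod_cast (Finset.sdiff_subset))
  have hq2 := card_inter_clF_pair_le_two_of_indep hind (a := x) (b := y)
  apply basis_pair_fair_of_line_hit_up hG hd hk hs hl hnf hB hnP hz hl0 hx hy hxy (by omega)
  rw [hd6, hk5]
  exact one_le_lineHitUpIncome_six_five hq2

end PercRepro.Shadow
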